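import Summits.BirchSwinnertonDyer.BirchSwinnertonDyer.Theorems.SignedLowerHalvesSprungLowerDivisibilityAtThreeCyclotomicCertDoor
import Literature.NumberTheory.EllipticCurves.Sprung2017.SharpFlatNonvanishingProofs
import Literature.NumberTheory.EllipticCurves.PAdicLFunctionInterpolationProofs
import Literature.NumberTheory.EllipticCurves.PAdicPowerSeriesZeros
import Literature.NumberTheory.EllipticCurves.PAdicLFunctionNeZeroHoldsProofs
import HarnessLib

/-!
# Crux `SprungLowerDivisibilityAtThree` (item stmt-BirchSwinnertonDyer-19875), line `chromatic-common-zeros`, stub S4b-cyc: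
# a CYCLOTOMIC COMMON ZERO OF POSITIVE LEVEL KILLS EVERY BIRCH SUM OF THAT LEVEL (the colour-free reading)

Cell `bsd-ssimc` (host) / lead `cruxlead-stmt-BirchSwinnertonDyer-19875` (g3), lane (C) of BRIEFS v4; `--supports` 19875
`--as helper`; theorems only; closes NO item; K1 / S4b-cyc / BSD / leaf X8 are NOT proved by anything here.

## The observation

Sprung's pair is pinned by the Mazur–Tate congruences `θ_n ≡ −(u_n·L♯ + v_n·L♭) (mod ω_n)` at every level `n`
(`Sprung2017.IsSprungPair`). If `Φ_{p^j}(1+T)` divides BOTH `L♯` and `L♭` in `Λ = ℤ_p⟦T⟧` — the situation at a common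
zero of the pair at the height-one prime `(Φ_{p^j}(1+T))`, which is exactly the hypothesis of the registered stub S4b-cyc
`stub_cyclotomicLowerPosLevel` of skeleton v8 — then it divides the level-`j` combination `u_j L♯ + v_j L♭`, and the
congruence, evaluated at `ζ − 1` for `ζ = χ(γ)` a PRIMITIVE `p^j`-th root of unity (`IsCongrModOmega.eval₂_eq`;
`Φ_{p^j}(ζ) = 0`), gives `θ_j(ζ − 1) = 0`, i.e. (`eval₂_mazurTateElement_eq_ratTwistedSymbolSum`)

  `∑_{a mod p^{j+e₀}} χ(a)·[a/p^{j+e₀}]⁺_f = 0` for EVERY even `p`-power-order character `χ` mod `p^{j+e₀}` with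
  `χ(γ)` of exact order `p^j` (general `p`, `N`, `f`, `a_p`; no curve, no supersingularity, no rank hypothesis).

By Birch's formula this Birch sum is `τ(χ)·L(f, χ̄, 1)/Ω⁺_f`, so the cyclotomic common zeros of positive level live
exactly over the EXCEPTIONAL ZEROS of the twisted `L`-values at conductor `p^{j+e₀}` (finitely many `j` per curve by
Rohrlich). Contrapositive = a per-pair CERTIFICATE in exact rational modular-symbol data: ONE non-vanishing Birch sum of
exact level `j` excludes a common zero at `(Φ_{p^j}(1+T))` — it supplies the level-`j` clause of the hypothesis `hcert`
of `X_mem_of_cyclotomic_common_of_cert` / `stub_cyclotomicLowerRest_of_cert` (`…CyclotomicCertDoor`) without any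
`p`-adic approximation of `L♯`, `L♭`. (Level one with `L♯ = 0` is w3's `…SharpLevelOneDoor`; this is every level, both
colours divisible.)

## Contents
* §1 `tsum_coeff_mul_pow_eq_zero_of_cyclotomic_comp_dvd` — an element of `Λ` divisible by `Φ_{p^j}(1+T)` vanishes
  at `ζ − 1`, `ζ` primitive of order `p^j` (evaluation on the open unit disc of `ℂ_p` is multiplicative).
* §2 `ratTwistedSymbolSum_eq_zero_of_cyclotomic_comp_dvd`, `not_cyclotomic_common_dvd_of_ratTwistedSymbolSum_ne_zero`
  (general `p`).
* §3 `twistedLValue_eq_zero_of_cyclotomic_comp_dvd` — Birch's formula (`ratTwistedSymbolSum_mul_plusPeriod_holds`,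
  `τ(χ) ≠ 0`): for a rational newform and a character with values in a field `K` embedded in `ℂ` and in `ℂ_p`, the
  entire continuation of `L(f, χ̄_ℂ, s)` vanishes at `s = 1` (general `p`).
* §4 the X8 reading in the binder prefix of S4b-cyc (the Néron-normalised `G♯, G♭` in a height-one
  `𝔭 ∋ Φ_{3^j}(1+T)`, `j ≥ 1`; period unit `h3`): `cyclotomic_comp_dvd_of_cyclotomicCommonZero` (both colours divisible),
  `ratTwistedSymbolSum_eq_zero_of_cyclotomicCommonZero`, `twistedLValue_eq_zero_of_cyclotomicCommonZero`.

References: [Sprung2017] Cor. 4.4–4.5, Thm. 1.12; [Pollack2003] Prop. 6.9 and 6.18 (proofs); [MazurTateTeitelbaum1986Invent]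
§I.8 (8.6), §I.13; [Rohrlich1984] Thm.; [Washington1997] §7.1, §13.2; [Sprung2015] Prop. 5.2, Conj. 5.6.
-/

set_option linter.dupNamespace false
set_option autoImplicit false

noncomputable section

open scoped Classical MatrixGroups ModularForm Polynomial

open CongruenceSubgroup WeierstrassCurve Polynomial
  Literature.NumberTheory.EllipticCurves Literature.NumberTheory.EllipticCurves.ModularForms
  Literature.NumberTheory.EllipticCurves.Sprung2017 Literature.NumberTheory.EllipticCurves.Rank1Residual

namespace Summit.BirchSwinnertonDyer.BirchSwinnertonDyer.Theorems.ChromaticCommonZeros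

section General

variable {p : ℕ} [Fact p.Prime]

/-! ### §1 Elements of `Λ` divisible by `Φ_{p^j}(1+T)` vanish at the primitive `p^j`-th roots of unity -/

/-- **`Φ_{p^j}(1+T) ∣ A ⟹ A(ζ − 1) = 0`** for `A ∈ Λ = ℤ_p⟦T⟧` and `ζ ∈ ℂ_p` a primitive `p^j`-th root of unity, where
`A(z) = ∑_k a_k z^k` (`|ζ − 1| < 1`): evaluation on the open unit disc is multiplicative (`tsum_map_coeff_mul_mul_pow`),
the polynomial factor evaluates to `Φ_{p^j}(ζ) = 0` (`Polynomial.isRoot_cyclotomic_iff`). [cite: Washington1997, §7.1] -/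
theorem tsum_coeff_mul_pow_eq_zero_of_cyclotomic_comp_dvd {A : IwasawaAlgebra p} {j : ℕ}
    (hA : ((((cyclotomic (p ^ j) ℤ).comp (X + 1)).map (Int.castRingHom ℤ_[p]) : ℤ_[p][X]) :
      IwasawaAlgebra p) ∣ A)
    {ζ : ℂ_[p]} (hζ : IsPrimitiveRoot ζ (p ^ j)) :
    ∑' k, ((algebraMap ℚ_[p] ℂ_[p]).comp (algebraMap ℤ_[p] ℚ_[p])) (PowerSeries.coeff k A) * (ζ - 1) ^ k
      = 0 := by
  have hp : p.Prime := Fact.out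
  obtain ⟨M, rfl⟩ := hA
  set ιZ : ℤ_[p] →+* ℂ_[p] := (algebraMap ℚ_[p] ℂ_[p]).comp (algebraMap ℤ_[p] ℚ_[p]) with hιZ
  have hz : ‖ζ - 1‖ < 1 := norm_sub_one_lt_one_of_pow_prime_pow_eq_one hζ.pow_eq_one
  rw [tsum_map_coeff_mul_mul_pow ιZ (norm_algebraMap_coeff_le_one _) (norm_algebraMap_coeff_le_one M) hz,
    (hasSum_map_coeff_coe_mul_pow ιZ _ (ζ - 1)).tsum_eq]
  -- the polynomial factor vanishes at `ζ − 1`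
  have hΦ : (((cyclotomic (p ^ j) ℤ).comp (X + 1)).map (Int.castRingHom ℤ_[p])).eval₂ ιZ (ζ - 1) = 0 := by
    rw [eval₂_map, RingHom.ext_int (ιZ.comp (Int.castRingHom ℤ_[p])) (Int.castRingHom ℂ_[p]), eval₂_comp,
      eval₂_add, eval₂_X, eval₂_one, sub_add_cancel, eval₂_eq_eval_map, map_cyclotomic]
    haveI : NeZero (p ^ j) := ⟨pow_ne_zero _ hp.ne_zero⟩
    exact Polynomial.isRoot_cyclotomic_iff.mpr hζ
  rw [hΦ, zero_mul]

/-! ### §2 Both colours divisible by `Φ_{p^j}(1+T)` ⟹ every Birch sum of exact level `j` vanishes -/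

variable {N : ℕ} {f : CuspForm (Gamma0 N) 2}

/-- **A cyclotomic common zero of a Sprung pair at level `j` kills the Birch sums of exact level `j`** (general `p`,
`N`, `f`, `a`). If `(L♯, L♭)` is a Sprung pair of `(f, p, a)` and `Φ_{p^j}(1+T)` divides both `L♯` and `L♭` in `Λ`, then
for every Dirichlet character `χ` modulo `p^{j+e₀}` with values in `ℂ_p`, even, of `p`-power order, whose value at the
cyclotomic generator `γ` is a PRIMITIVE `p^j`-th root of unity: `∑_{a mod p^{j+e₀}} χ(a)·[a/p^{j+e₀}]⁺_f = 0`. Proof: the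
level-`j` congruence `θ_j ≡ −(u_j L♯ + v_j L♭) (mod ω_j)` (`IsSprungPair`) evaluated at `χ(γ) − 1`
(`IsCongrModOmega.eval₂_eq`; `χ(γ)^{p^j} = 1`), §1 for `u_j L♯ + v_j L♭`, and
`eval₂_mazurTateElement_eq_ratTwistedSymbolSum`. [cite: Sprung2017, Cor. 4.4–4.5 and Thm. 1.12]
[cite: Pollack2003, Prop. 6.9 and Prop. 6.18 (proofs)] [cite: MazurTateTeitelbaum1986Invent, §I.13] -/
theorem ratTwistedSymbolSum_eq_zero_of_cyclotomic_comp_dvd {a : ℤ} {Lsharp Lflat : IwasawaAlgebra p}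
    (hSP : IsSprungPair f p a Lsharp Lflat) {j : ℕ}
    (hs : ((((cyclotomic (p ^ j) ℤ).comp (X + 1)).map (Int.castRingHom ℤ_[p]) : ℤ_[p][X]) :
      IwasawaAlgebra p) ∣ Lsharp)
    (hfl : ((((cyclotomic (p ^ j) ℤ).comp (X + 1)).map (Int.castRingHom ℤ_[p]) : ℤ_[p][X]) :
      IwasawaAlgebra p) ∣ Lflat)
    (χ : DirichletCharacter ℂ_[p] (p ^ (j + cyclotomicExponent p))) (hev : χ.Even)
    (hord : ∃ i : ℕ, orderOf χ = p ^ i)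
    (hζ : IsPrimitiveRoot (χ (cyclotomicGenerator p : ZMod (p ^ (j + cyclotomicExponent p)))) (p ^ j)) :
    ratTwistedSymbolSum f χ = 0 := by
  have h := hSP j
  set ζ : ℂ_[p] := χ (cyclotomicGenerator p : ZMod (p ^ (j + cyclotomicExponent p))) with hζdef
  have hz : ‖ζ - 1‖ < 1 := norm_sub_one_lt_one_of_pow_prime_pow_eq_one hζ.pow_eq_one
  have hzn : (1 + (ζ - 1)) ^ p ^ j = 1 := by rw [add_sub_cancel]; exact hζ.pow_eq_one
  have h1 := h.eval₂_eq hz hzn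
  rw [eval₂_mazurTateElement_eq_ratTwistedSymbolSum f χ hev hord,
    tsum_coeff_mul_pow_eq_zero_of_cyclotomic_comp_dvd
      (dvd_add (dvd_mul_of_dvd_right hs _) (dvd_mul_of_dvd_right hfl _)) hζ, mul_zero] at h1
  exact h1

/-- **Certificate form (contrapositive)**: ONE non-vanishing Birch sum at an even `p`-power-order character of
modulus `p^{j+e₀}` whose value at `γ` is a primitive `p^j`-th root of unity EXCLUDES a common zero of the Sprung pair
at `(Φ_{p^j}(1+T))` — the level-`j` clause of the certificate `hcert` of `X_mem_of_cyclotomic_common_of_cert` /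
`stub_cyclotomicLowerRest_of_cert`, in exact rational modular-symbol data. [cite: Sprung2015, Prop. 5.2 and Conj. 5.6]
[cite: MazurTateTeitelbaum1986Invent, §I.8 (8.6)] -/
theorem not_cyclotomic_common_dvd_of_ratTwistedSymbolSum_ne_zero {a : ℤ} {Lsharp Lflat : IwasawaAlgebra p}
    (hSP : IsSprungPair f p a Lsharp Lflat) {j : ℕ}
    (χ : DirichletCharacter ℂ_[p] (p ^ (j + cyclotomicExponent p))) (hev : χ.Even)
    (hord : ∃ i : ℕ, orderOf χ = p ^ i)
    (hζ : IsPrimitiveRoot (χ (cyclotomicGenerator p : ZMod (p ^ (j + cyclotomicExponent p)))) (p ^ j))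
    (hne : ratTwistedSymbolSum f χ ≠ 0) :
    ¬ (((((cyclotomic (p ^ j) ℤ).comp (X + 1)).map (Int.castRingHom ℤ_[p]) : ℤ_[p][X]) :
          IwasawaAlgebra p) ∣ Lsharp ∧
       ((((cyclotomic (p ^ j) ℤ).comp (X + 1)).map (Int.castRingHom ℤ_[p]) : ℤ_[p][X]) :
          IwasawaAlgebra p) ∣ Lflat) :=
  fun h ↦ hne (ratTwistedSymbolSum_eq_zero_of_cyclotomic_comp_dvd hSP h.1 h.2 χ hev hord hζ)

end General

/-! ### §3 Birch's formula: the twisted `L`-value at `s = 1` vanishes -/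

section LValue

variable {p : ℕ} [Fact p.Prime] {N : ℕ} [NeZero N] {f : CuspForm (Gamma0 N) 2}

/-- **A cyclotomic common zero of a Sprung pair at level `j` kills `L(f, χ̄, 1)` for every character of exact level `j`**
(general `p`; `f` a rational newform). Let `ψ` be a Dirichlet character modulo `p^{j+e₀}` with values in a field `K`
embedded into `ℂ` by `σ` and into `ℂ_p` by `τ`, primitive, even, of `p`-power order, with `ψ(γ)` a primitive `p^j`-th root
of unity, and let `L` be the entire continuation of `L(f, (σψ)⁻¹, s)`. If `Φ_{p^j}(1+T)` divides both colours of a Sprung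
pair of `f` at `p`, then `L(1) = 0`: §2 for `τψ` (transport `ratTwistedSymbolSum_ringHomComp`, `τ`, `σ` injective), then
Birch's formula `(∑ σψ(a)[a/m]⁺)·Ω⁺_f = τ(σψ)·L(1)` (`ratTwistedSymbolSum_mul_plusPeriod_holds`) and `τ(σψ) ≠ 0`
(`gaussSum_stdAddChar_ne_zero`). [cite: MazurTateTeitelbaum1986Invent, §I.8 (8.6)] [cite: Sprung2017, Cor. 4.4, Thm. 1.12]
[cite: Rohrlich1984, Thm. (finiteness of the exceptional set)] -/
theorem twistedLValue_eq_zero_of_cyclotomic_comp_dvd {K : Type*} [Field K] (σ : K →+* ℂ) (τ : K →+* ℂ_[p])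
    (hf0 : IsNewform0 f) (hQ : coeffField f = ⊥) {a : ℤ} {Lsharp Lflat : IwasawaAlgebra p}
    (hSP : IsSprungPair f p a Lsharp Lflat) {j : ℕ}
    (hs : ((((cyclotomic (p ^ j) ℤ).comp (X + 1)).map (Int.castRingHom ℤ_[p]) : ℤ_[p][X]) :
      IwasawaAlgebra p) ∣ Lsharp)
    (hfl : ((((cyclotomic (p ^ j) ℤ).comp (X + 1)).map (Int.castRingHom ℤ_[p]) : ℤ_[p][X]) :
      IwasawaAlgebra p) ∣ Lflat)
    (ψ : DirichletCharacter K (p ^ (j + cyclotomicExponent p))) (hprim : ψ.IsPrimitive) (hev : ψ.Even)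
    (hord : ∃ i : ℕ, orderOf ψ = p ^ i)
    (hζ : IsPrimitiveRoot (ψ (cyclotomicGenerator p : ZMod (p ^ (j + cyclotomicExponent p)))) (p ^ j))
    {L : ℂ → ℂ} (hLd : Differentiable ℂ L)
    (hL : ∀ s : ℂ, 2 < s.re → L s = twistedLSeries f (ψ.ringHomComp σ)⁻¹ s) :
    L 1 = 0 := by
  -- the Birch sum over `ℂ_p` vanishes (§2), hence over `K`, hence over `ℂ`
  have hτ : ratTwistedSymbolSum f (ψ.ringHomComp τ) = 0 := by
    refine ratTwistedSymbolSum_eq_zero_of_cyclotomic_comp_dvd hSP hs hfl (ψ.ringHomComp τ)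
      ((even_ringHomComp_iff τ ψ).mpr hev) (by rw [orderOf_ringHomComp]; exact hord) ?_
    rw [MulChar.ringHomComp_apply]
    exact hζ.map_of_injective τ.injective
  rw [ratTwistedSymbolSum_ringHomComp, map_eq_zero] at hτ
  have hσ : ratTwistedSymbolSum f (ψ.ringHomComp σ) = 0 := by
    rw [ratTwistedSymbolSum_ringHomComp, hτ, map_zero]
  -- Birch's formula and `τ(σψ) ≠ 0`
  have hprimC : DirichletCharacter.IsPrimitive (ψ.ringHomComp σ) := (isPrimitive_ringHomComp_iff σ ψ).mpr hprim
  have hBirch := ratTwistedSymbolSum_mul_plusPeriod_holds (f := f) hf0 hQ hprimC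
    ((even_ringHomComp_iff σ ψ).mpr hev) hLd hL
  rw [hσ, zero_mul, eq_comm, mul_eq_zero] at hBirch
  exact hBirch.resolve_left (gaussSum_stdAddChar_ne_zero hprimC)

end LValue

/-! ### §4 The X8 reading: S4b-cyc's hypothesis forces exceptional vanishing at that level -/

section X8

/-- **At a cyclotomic common zero of positive level on class X8, `Φ_{p^j}(1+T)` divides BOTH colours.** In the binder
prefix of the registered stub S4b-cyc `stub_cyclotomicLowerPosLevel` (skeleton v8 of line `chromatic-common-zeros`): an
X8 pair `(W, p)` (`p = 3`), a newform `f` of `W`, a period ratio `ϖ` (`ϖ·Ω_W = Ω⁺_f`), a Sprung pair `(L♯, L♭)`, a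
height-one prime `𝔭` of `Λ` containing `Φ_{p^j}(1+T)` for some `j ≥ 1` AND the Néron-normalised `L`-function `G^•`
(`ι G^• = C(ϖ)·ι L^•`) of EVERY colour `•`. Then `Φ_{p^j}(1+T) ∣ L♯` and `∣ L♭`: `𝔭 = (Φ_{p^j}(1+T))`
(`prime_cyclotomic_comp`, `Ideal.eq_span_singleton_of_height_eq_one`) and `G^• ∈ 𝔭 ⟹ L^• ∈ 𝔭` (period unit `h3`,
`chromaticL_mem_of_normalised_mem`; the `G^•` exist by `stub_periodMu`). CONDITIONAL on the displayed named fact `h3`.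
[cite: GreenbergVatsal2000, §3 Rem. 3.4] [cite: Washington1997, §7.1 and §13.2] -/
theorem cyclotomic_comp_dvd_of_cyclotomicCommonZero (h3 : realPeriodRat_eq_unit_mul_plusPeriod_three)
    (W : WeierstrassCurve ℚ) [W.IsElliptic] [W.IsGloballyMinimal] (p : ℕ) [Fact p.Prime] (hX : ClassX8 W p)
    {N : ℕ} [hN : NeZero N] (f : CuspForm (Gamma0 N) 2) (hf : IsNewformOf W f) (ϖ : ℚ)
    (hϖ : (ϖ : ℝ) * W.realPeriodRat = plusPeriod f) (Lsharp Lflat : IwasawaAlgebra p)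
    (hSP : IsSprungPair f p (W.frobeniusTrace p) Lsharp Lflat)
    (𝔭 : PrimeSpectrum (IwasawaAlgebra p)) (h𝔭 : 𝔭.asIdeal.height = 1) {j : ℕ} (hj : 1 ≤ j)
    (hΦ : ((((cyclotomic (p ^ j) ℤ).comp (X + 1)).map (Int.castRingHom ℤ_[p]) : ℤ_[p][X]) :
      PowerSeries ℤ_[p]) ∈ 𝔭.asIdeal)
    (hcommon : ∀ (col' : Chroma) (G' : IwasawaAlgebra p),
      iwasawaToPowerSeries p G' =
        PowerSeries.C (ϖ : ℚ_[p]) * iwasawaToPowerSeries p (chromaticL col' Lsharp Lflat) →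
      G' ∈ 𝔭.asIdeal) :
    ((((cyclotomic (p ^ j) ℤ).comp (X + 1)).map (Int.castRingHom ℤ_[p]) : ℤ_[p][X]) :
        IwasawaAlgebra p) ∣ Lsharp ∧
      ((((cyclotomic (p ^ j) ℤ).comp (X + 1)).map (Int.castRingHom ℤ_[p]) : ℤ_[p][X]) :
        IwasawaAlgebra p) ∣ Lflat := by
  -- the normalised `G^•` exist and lie in `𝔭`, hence so do `L♯`, `L♭` (period unit)
  obtain ⟨hG, -⟩ := stub_periodMu h3 W p hX N hN f ϖ Lsharp Lflat hf hϖ hSP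
  have hmem : ∀ col : Chroma, chromaticL col Lsharp Lflat ∈ 𝔭.asIdeal := fun col ↦ by
    obtain ⟨G, hGn⟩ := hG col
    exact chromaticL_mem_of_normalised_mem h3 W p hX f hf ϖ hϖ Lsharp Lflat col hGn 𝔭 (hcommon col G hGn)
  -- `𝔭 = (Φ_{p^j}(1+T))`, a prime element
  obtain ⟨k, rfl⟩ : ∃ k, j = k + 1 := ⟨j - 1, by omega⟩
  have heq := Ideal.eq_span_singleton_of_height_eq_one h𝔭 hΦ (prime_cyclotomic_comp (p := p) k)
  exact ⟨Ideal.mem_span_singleton.mp (heq ▸ hmem Chroma.sharp),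
    Ideal.mem_span_singleton.mp (heq ▸ hmem Chroma.flat)⟩

/-- **At a cyclotomic common zero of positive level on class X8, every Birch sum of that level vanishes** (same binder
prefix as `cyclotomic_comp_dvd_of_cyclotomicCommonZero`): for every even `p`-power-order character `χ` mod `p^{j+e₀}`
with values in `ℂ_p` and `χ(γ)` primitive of order `p^j`, `∑_a χ(a)·[a/p^{j+e₀}]⁺_f = 0`. The locus of stub S4b-cyc lies
over the EXCEPTIONAL ZEROS of the Birch sums (equivalently, §3, of the twisted `L`-values of conductor `3^{j+1}`).
CONDITIONAL on the displayed named fact `h3` only. [cite: Sprung2017, Cor. 4.4–4.5, Thm. 1.12]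
[cite: MazurTateTeitelbaum1986Invent, §I.8 (8.6), §I.13] [cite: GreenbergVatsal2000, §3 Rem. 3.4] -/
theorem ratTwistedSymbolSum_eq_zero_of_cyclotomicCommonZero (h3 : realPeriodRat_eq_unit_mul_plusPeriod_three)
    (W : WeierstrassCurve ℚ) [W.IsElliptic] [W.IsGloballyMinimal] (p : ℕ) [Fact p.Prime] (hX : ClassX8 W p)
    {N : ℕ} [NeZero N] (f : CuspForm (Gamma0 N) 2) (hf : IsNewformOf W f) (ϖ : ℚ)
    (hϖ : (ϖ : ℝ) * W.realPeriodRat = plusPeriod f) (Lsharp Lflat : IwasawaAlgebra p)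
    (hSP : IsSprungPair f p (W.frobeniusTrace p) Lsharp Lflat)
    (𝔭 : PrimeSpectrum (IwasawaAlgebra p)) (h𝔭 : 𝔭.asIdeal.height = 1) {j : ℕ} (hj : 1 ≤ j)
    (hΦ : ((((cyclotomic (p ^ j) ℤ).comp (X + 1)).map (Int.castRingHom ℤ_[p]) : ℤ_[p][X]) :
      PowerSeries ℤ_[p]) ∈ 𝔭.asIdeal)
    (hcommon : ∀ (col' : Chroma) (G' : IwasawaAlgebra p),
      iwasawaToPowerSeries p G' =
        PowerSeries.C (ϖ : ℚ_[p]) * iwasawaToPowerSeries p (chromaticL col' Lsharp Lflat) →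
      G' ∈ 𝔭.asIdeal)
    (χ : DirichletCharacter ℂ_[p] (p ^ (j + cyclotomicExponent p))) (hev : χ.Even)
    (hord : ∃ i : ℕ, orderOf χ = p ^ i)
    (hζ : IsPrimitiveRoot (χ (cyclotomicGenerator p : ZMod (p ^ (j + cyclotomicExponent p)))) (p ^ j)) :
    ratTwistedSymbolSum f χ = 0 := by
  obtain ⟨hs, hfl⟩ := cyclotomic_comp_dvd_of_cyclotomicCommonZero h3 W p hX f hf ϖ hϖ Lsharp Lflat hSP 𝔭 h𝔭
    hj hΦ hcommon
  exact ratTwistedSymbolSum_eq_zero_of_cyclotomic_comp_dvd hSP hs hfl χ hev hord hζ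

/-- **At a cyclotomic common zero of positive level on class X8, `L(E, χ̄, 1) = 0` for every character of that level**
(same binder prefix; `ψ` with values in a field `K` embedded in `ℂ` and `ℂ_p`, primitive, even, of `p`-power order,
`ψ(γ)` primitive of order `p^j`; `L` the entire continuation of `L(f, (σψ)⁻¹, s) = L(E, (σψ)⁻¹, s)`): the hypothesis of
stub S4b-cyc at `(Φ_{3^j}(1+T))` can only be met at an EXCEPTIONAL ZERO of the twisted `L`-values of `E` of conductor
`3^{j+1}` (finitely many `j` per curve by Rohrlich). CONDITIONAL on the displayed named fact `h3` only; this reads the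
hypothesis of S4b-cyc, it does NOT prove the stub. [cite: MazurTateTeitelbaum1986Invent, §I.8 (8.6)]
[cite: Sprung2017, Cor. 4.4, Thm. 1.12] [cite: Rohrlich1984, Thm.] [cite: GreenbergVatsal2000, §3 Rem. 3.4] -/
theorem twistedLValue_eq_zero_of_cyclotomicCommonZero (h3 : realPeriodRat_eq_unit_mul_plusPeriod_three)
    (W : WeierstrassCurve ℚ) [W.IsElliptic] [W.IsGloballyMinimal] (p : ℕ) [Fact p.Prime] (hX : ClassX8 W p)
    {N : ℕ} [NeZero N] (f : CuspForm (Gamma0 N) 2) (hf : IsNewformOf W f) (ϖ : ℚ)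
    (hϖ : (ϖ : ℝ) * W.realPeriodRat = plusPeriod f) (Lsharp Lflat : IwasawaAlgebra p)
    (hSP : IsSprungPair f p (W.frobeniusTrace p) Lsharp Lflat)
    (𝔭 : PrimeSpectrum (IwasawaAlgebra p)) (h𝔭 : 𝔭.asIdeal.height = 1) {j : ℕ} (hj : 1 ≤ j)
    (hΦ : ((((cyclotomic (p ^ j) ℤ).comp (X + 1)).map (Int.castRingHom ℤ_[p]) : ℤ_[p][X]) :
      PowerSeries ℤ_[p]) ∈ 𝔭.asIdeal)
    (hcommon : ∀ (col' : Chroma) (G' : IwasawaAlgebra p),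
      iwasawaToPowerSeries p G' =
        PowerSeries.C (ϖ : ℚ_[p]) * iwasawaToPowerSeries p (chromaticL col' Lsharp Lflat) →
      G' ∈ 𝔭.asIdeal)
    {K : Type*} [Field K] (σ : K →+* ℂ) (τ : K →+* ℂ_[p])
    (ψ : DirichletCharacter K (p ^ (j + cyclotomicExponent p))) (hprim : ψ.IsPrimitive) (hev : ψ.Even)
    (hord : ∃ i : ℕ, orderOf ψ = p ^ i)
    (hζ : IsPrimitiveRoot (ψ (cyclotomicGenerator p : ZMod (p ^ (j + cyclotomicExponent p)))) (p ^ j))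
    {L : ℂ → ℂ} (hLd : Differentiable ℂ L)
    (hL : ∀ s : ℂ, 2 < s.re → L s = twistedLSeries f (ψ.ringHomComp σ)⁻¹ s) :
    L 1 = 0 := by
  obtain ⟨hs, hfl⟩ := cyclotomic_comp_dvd_of_cyclotomicCommonZero h3 W p hX f hf ϖ hϖ Lsharp Lflat hSP 𝔭 h𝔭
    hj hΦ hcommon
  exact twistedLValue_eq_zero_of_cyclotomic_comp_dvd σ τ hf.1 hf.coeffField_eq_bot hSP hs hfl ψ hprim hev hord hζ
    hLd hL

end X8

end Summit.BirchSwinnertonDyer.BirchSwinnertonDyer.Theorems.ChromaticCommonZeros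

end
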